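import Summits.AtomisticToContinuum.Crystallization.Theses.ThreeConeCertificate
import Summits.AtomisticToContinuum.Crystallization.Theorems.ThreeConeCertificateExactCertificateNoGapPeriodic

/-!
# `ExactCertificate` (stmt-AtomisticToContinuum-11959), line `Ideator5Sketch`: the composition stub

Registered stub `stub_composition` of the skeleton for the crux
`Summit.AtomisticToContinuum.Crystallization.Theses.ThreeConeCertificate.ExactCertificate`
(idea card `robust-soft-flyspeck`).

**Theorem (`stub_composition`).**  A template periodic configuration `P₀`, a range `ρ`, a radial
positive-type `f` dominated by `V_LJ` on `[ρ,∞) ∩ (0,∞)`, and the PERIODIC core bound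
`e_LJ(P₀) + f 0/2 ≤ e_Q((V_LJ − f)·1_{(0,ρ)})` for every periodic `Q` give `ExactCertificate`.

Proof: the normal-form split `g := (V_LJ − f)·1_{(0,ρ)}`, `U := (V_LJ − f)·1_{[ρ,∞)}`,
`c := −(e_LJ(P₀) + f 0/2)` with witness `P := P₀`.  (S1) is the case split `r < ρ` / `ρ ≤ r`; (S2) is
`f ≤ V_LJ` on the tail; (S3) is the definition of `g`; (S4) is the hypothesis; (S6) holds by `ring`; and the
stability clause (S5) is the tree's periodisation lemma `NoGap.stable_of_periodic_bound` — a periodic lower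
bound for a finite-range potential is a stability constant on all finite injective configurations.
All `[folklore]`.
-/

noncomputable section

namespace Summit.AtomisticToContinuum.Crystallization.Theorems.ThreeConeCertificateExactCertificate.Design

open Literature.MathematicalPhysics.StatisticalMechanics
open Summit.AtomisticToContinuum.Crystallization.Theses.ThreeConeCertificate
open Summit.AtomisticToContinuum.Crystallization.Theorems.ThreeConeCertificateExactCertificate.NoGap
  (stable_of_periodic_bound)
open scoped BigOperators

/-- **Registered stub `stub_composition` of crux item stmt-AtomisticToContinuum-11959 (line `Ideator5Sketch`;
signature verbatim): design + periodic core bound ⇒ the crux.**  A template `P₀`, a range `ρ`, a radial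
positive-type `f` with `f ≤ V_LJ` on `[ρ,∞) ∩ (0,∞)`, and the periodic lower bound
`e_LJ(P₀) + f 0/2 ≤ e_Q((V_LJ − f)·1_{(0,ρ)})` for every periodic `Q` give `ExactCertificate`, with the
normal-form split `g := (V_LJ − f)1_{(0,ρ)}`, `U := (V_LJ − f)1_{[ρ,∞)}`, `c := −(e_LJ(P₀) + f 0/2)` and
(S5) from `NoGap.stable_of_periodic_bound`. [folklore] -/
theorem stub_composition : ∀ (P₀ : PeriodicConfiguration 3) (ρ : ℝ) (f : ℝ → ℝ),
    (∀ (n : ℕ) (y : Fin n → EuclideanSpace ℝ (Fin 3)) (w : Fin n → ℝ),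
      0 ≤ ∑ i, ∑ j, w i * w j * f (dist (y i) (y j))) →
    (∀ r : ℝ, ρ ≤ r → 0 < r → f r ≤ lennardJones r) →
    (∀ Q : PeriodicConfiguration 3,
      P₀.energyPerParticle lennardJones + f 0 / 2 ≤
        Q.energyPerParticle (fun r => if r < ρ then lennardJones r - f r else 0)) →
    ExactCertificate := by
  intro P₀ ρ f hpd htail hcore
  refine ⟨P₀, ρ, -(P₀.energyPerParticle lennardJones + f 0 / 2),
    fun r => if r < ρ then lennardJones r - f r else 0,
    fun r => if r < ρ then 0 else lennardJones r - f r, f, ?_, ?_, ?_, hpd, ?_, by ring⟩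
  · intro r _
    show lennardJones r =
      (if r < ρ then lennardJones r - f r else 0) + (if r < ρ then 0 else lennardJones r - f r) + f r
    by_cases h : r < ρ
    · rw [if_pos h, if_pos h]; ring
    · rw [if_neg h, if_neg h]; ring
  · intro r hr
    show 0 ≤ (if r < ρ then 0 else lennardJones r - f r)
    by_cases h : r < ρ
    · rw [if_pos h]
    · rw [if_neg h, sub_nonneg]
      exact htail r (not_lt.1 h) hr
  · intro r hr
    show (if r < ρ then lennardJones r - f r else 0) = 0
    rw [if_neg (not_lt.2 hr)]
  · intro N x hx
    have h1 := stable_of_periodic_bound (W := fun r => if r < ρ then lennardJones r - f r else 0) (ρ := ρ)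
      (fun r hr => by
        show (if r < ρ then lennardJones r - f r else 0) = 0
        rw [if_neg (not_lt.2 hr)]) hcore hx
    linarith

end Summit.AtomisticToContinuum.Crystallization.Theorems.ThreeConeCertificateExactCertificate.Design

end
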